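import Mathlib.Analysis.SpecialFunctions.Pow.Real
import Literature.NumberTheory.Sieve.IwaniecAlmostPrimesMertens

/-!
# SoloInformedBalancedRangeSign — the balanced half `(R2)_ε` is a SIGN statement: in absolute value it fails by a factor `log x`

Solo unit `solo-Parity-informed` (ideation tier, informed mode), session 8; `PLAN.md` §15.3, CLAIMS C40
(referee-notes R17(a) made a theorem).

The two-range schema (`SoloInformedConjEIffLargeDivisors.hardyLittlewoodConjE_of_twoRanges`) asks, in its balanced
range, for
  `(R2)_ε   ∀ δ > 0:  |∑_{x^{1-ε} < d ≤ x^{1+ε}} μ(d) log d · rem(x; d)| ≤ δ x`  eventually,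
where `rem(x; d) = #{n ≤ x : d ∣ n²+1} - x ρ(d)/d`.  This is NOT a level-of-distribution statement: the same sum with
absolute values inside is `≫ x log x`.  Reason: for a prime `p > 4x` the class count `#{n ≤ x : p ∣ n² + 1}` is an
integer while its model `x ρ(p)/p` is `≤ 1/2`, so `|rem(x; p)| ≥ x ρ(p)/p` whatever the count is, and
`∑_{4x < p ≤ x^{1+ε}} ρ(p) log p/p = ε log x + O(1)` by Mertens' theorem for `ρ` (tree: `RhoMertensStrong_holds`).

* `rho_mul_div_le_abs_rem` — `x ρ(d)/d ≤ 1/2 ⟹ x ρ(d)/d ≤ |rem(x; d)|`;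
* `mul_rhoLogSum_sub_le_sum_primes` — `x · (R(D) - R(4x)) ≤ ∑_{4x < p ≤ D} log p · |rem(x; p)|` (`R = rhoLogSum`);
* `eventually_absBalancedRange_ge` — for every `ε > 0`, eventually
  `(ε/2) · x log x ≤ ∑_{x^{1-ε} < d ≤ x^{1+ε}} |μ(d) log d · rem(x; d)|`;
* `not_absBalancedRange_isLittleO` — hence the absolute-value form of `(R2)_ε` is false for every `ε > 0`.

So any proof of `(R2)_ε` must use the sign of `μ(d)` against the oscillation of `rem(x; d)` over `d ≍ x^{1±ε}`:
cancellation of the Möbius function over near-square-root divisors of `n² + 1` (a parity statement), not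
equidistribution of the roots of `ν² + 1 ≡ 0 (mod d)` — the density inputs of the Chebyshev–Hooley ladder cannot
supply it even in principle.  No bearing on the truth of the conjecture.
-/

namespace Summit.Parity.BatemanHorn.Theorems

open Finset Filter ArithmeticFunction
open scoped ArithmeticFunction.Moebius Topology
open Literature.NumberTheory.Sieve.Iwaniec1978 (rho congrCount rem rhoLogSum RhoMertensStrong_holds rho_le_two)

/-- If the model `x ρ(d)/d` of the class count is at most `1/2`, then `|rem(x; d)| ≥ x ρ(d)/d` (the count is an
integer: either `0`, and the remainder is minus the model, or `≥ 1 ≥ 1/2 + model`). -/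
theorem rho_mul_div_le_abs_rem {x : ℝ} (hx : 0 ≤ x) {d : ℕ} (h : (rho d : ℝ) * x / d ≤ 1 / 2) :
    (rho d : ℝ) * x / d ≤ |rem x d| := by
  unfold rem
  have hm0 : 0 ≤ (rho d : ℝ) * x / d := by positivity
  rcases Nat.eq_zero_or_pos (congrCount x d) with h0 | h1
  · rw [h0, Nat.cast_zero, zero_sub, abs_neg, abs_of_nonneg hm0]
  · have h1' : (1 : ℝ) ≤ congrCount x d := by exact_mod_cast h1
    rw [abs_of_nonneg (by linarith)]
    linarith

/-- `x · (R(D) - R(4x)) ≤ ∑_{p prime, 4x < p ≤ D} log p · |rem(x; p)|`, `R(t) = ∑_{p ≤ t} ρ(p) log p/p`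
(for primes `p > 4x`: `x ρ(p)/p ≤ 2x/p < 1/2`). -/
theorem mul_rhoLogSum_sub_le_sum_primes (x D : ℕ) (hD : 4 * x ≤ D) :
    (x : ℝ) * (rhoLogSum D - rhoLogSum ((4 * x : ℕ) : ℝ))
      ≤ ∑ p ∈ (Nat.primesLE D).filter (fun p : ℕ => 4 * x < p), Real.log p * |rem (x : ℝ) p| := by
  have hsplit : rhoLogSum D - rhoLogSum ((4 * x : ℕ) : ℝ)
      = ∑ p ∈ (Nat.primesLE D).filter (fun p : ℕ => 4 * x < p), (rho p : ℝ) * Real.log p / p := by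
    unfold rhoLogSum
    rw [Nat.floor_natCast, Nat.floor_natCast]
    have hle : Nat.primesLE (4 * x) = (Nat.primesLE D).filter (fun p : ℕ => ¬ 4 * x < p) := by
      ext p
      simp only [Nat.mem_primesLE, mem_filter, not_lt]
      constructor
      · rintro ⟨hp4, hp⟩
        exact ⟨⟨hp4.trans hD, hp⟩, hp4⟩
      · rintro ⟨⟨_, hp⟩, hp4⟩
        exact ⟨hp4, hp⟩
    rw [hle, ← sum_filter_add_sum_filter_not (Nat.primesLE D) (fun p : ℕ => 4 * x < p)]
    ring
  rw [hsplit, mul_sum]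
  refine sum_le_sum fun p hp => ?_
  obtain ⟨hpD, hp4⟩ := mem_filter.mp hp
  have hpr : p.Prime := (Nat.mem_primesLE.mp hpD).2
  have hp0 : (0 : ℝ) < p := by exact_mod_cast hpr.pos
  have hρ : (rho p : ℝ) ≤ 2 := by exact_mod_cast rho_le_two hpr
  have h4 : (4 * x : ℝ) < p := by exact_mod_cast hp4
  have hx0 : (0 : ℝ) ≤ x := Nat.cast_nonneg x
  have hhalf : (rho p : ℝ) * x / p ≤ 1 / 2 := by
    rw [div_le_iff₀ hp0]
    nlinarith
  have hrem := rho_mul_div_le_abs_rem hx0 hhalf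
  have hlog : 0 ≤ Real.log (p : ℝ) := Real.log_natCast_nonneg p
  calc (x : ℝ) * ((rho p : ℝ) * Real.log p / p) = Real.log p * ((rho p : ℝ) * x / p) := by ring
    _ ≤ Real.log p * |rem (x : ℝ) p| := mul_le_mul_of_nonneg_left hrem hlog

/-- The prime terms are part of the absolute `(R2)` sum: for `D' ≤ D` and `x^{1-ε} ≤ 4x`,
`∑_{4x < p ≤ D', p prime} log p |rem(x;p)| ≤ ∑_{d ≤ D, x^{1-ε} < d} |μ(d) log d · rem(x; d)|`. -/
theorem sum_primes_le_absBalancedRange {ε : ℝ} (x D : ℕ) (hx : 1 ≤ x) (hε : 0 ≤ ε) :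
    ∑ p ∈ (Nat.primesLE D).filter (fun p : ℕ => 4 * x < p), Real.log p * |rem (x : ℝ) p|
      ≤ ∑ d ∈ (Icc 1 D).filter (fun d : ℕ => (x : ℝ) ^ (1 - ε) < d),
          |(μ d : ℝ) * Real.log d * rem (x : ℝ) d| := by
  have hx1 : (1 : ℝ) ≤ x := by exact_mod_cast hx
  have hsub : (Nat.primesLE D).filter (fun p : ℕ => 4 * x < p)
      ⊆ (Icc 1 D).filter (fun d : ℕ => (x : ℝ) ^ (1 - ε) < d) := by
    intro p hp
    obtain ⟨hpD, hp4⟩ := mem_filter.mp hp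
    obtain ⟨hpD', hpr⟩ := Nat.mem_primesLE.mp hpD
    refine mem_filter.mpr ⟨mem_Icc.mpr ⟨hpr.one_le, hpD'⟩, ?_⟩
    have h4 : (4 * x : ℝ) < p := by exact_mod_cast hp4
    calc (x : ℝ) ^ (1 - ε) ≤ (x : ℝ) ^ (1 : ℝ) := Real.rpow_le_rpow_of_exponent_le hx1 (by linarith)
      _ = x := Real.rpow_one _
      _ < p := by linarith
  refine (sum_le_sum_of_subset_of_nonneg hsub fun d _ _ => abs_nonneg _).trans' ?_
  refine sum_le_sum fun p hp => ?_
  have hpr : p.Prime := (Nat.mem_primesLE.mp (mem_filter.mp hp).1).2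
  rw [abs_mul, abs_mul, abs_of_nonneg (Real.log_natCast_nonneg p)]
  have hμ : |(μ p : ℝ)| = 1 := by
    rw [ArithmeticFunction.moebius_apply_prime hpr]
    norm_num
  rw [hμ, one_mul]

/-- **The absolute `(R2)` sum is `≫ x log x`.**  For every `ε > 0`, eventually in `x`:
`(ε/2) · x · log x ≤ ∑_{d ≤ x^{1+ε}, d > x^{1-ε}} |μ(d) log d · rem(x; d)|`. -/
theorem eventually_absBalancedRange_ge {ε : ℝ} (hε : 0 < ε) :
    ∀ᶠ x : ℕ in atTop,
      ε / 2 * x * Real.log x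
        ≤ ∑ d ∈ (Icc 1 ⌊(x : ℝ) ^ (1 + ε)⌋₊).filter (fun d : ℕ => (x : ℝ) ^ (1 - ε) < d),
            |(μ d : ℝ) * Real.log d * rem (x : ℝ) d| := by
  obtain ⟨C, hC⟩ := RhoMertensStrong_holds
  have hC0 : 0 ≤ C := by
    have h := hC 1 le_rfl
    exact (abs_nonneg _).trans h
  have hlogT : Tendsto (fun x : ℕ => Real.log (x : ℝ)) atTop atTop :=
    Real.tendsto_log_atTop.comp tendsto_natCast_atTop_atTop
  -- eventually: `x^ε ≥ 8` and `(ε/2) log x ≥ log 8 + 2C`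
  have hpow : Tendsto (fun x : ℕ => (x : ℝ) ^ ε) atTop atTop :=
    (tendsto_rpow_atTop hε).comp tendsto_natCast_atTop_atTop
  filter_upwards [hpow.eventually_ge_atTop 8, hlogT.eventually_ge_atTop ((Real.log 8 + 2 * C) / (ε / 2)),
    eventually_ge_atTop 1] with x hx8 hxlog hx1
  have hX1 : (1 : ℝ) ≤ x := by exact_mod_cast hx1
  have hX0 : (0 : ℝ) < x := by linarith
  have hl0 : 0 ≤ Real.log (x : ℝ) := Real.log_nonneg hX1
  -- the level `D = ⌊x^{1+ε}⌋ ≥ 4x`, with `log D ≥ (1+ε) log x - log 2`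
  set D : ℕ := ⌊(x : ℝ) ^ (1 + ε)⌋₊ with hDdef
  have hxe : (x : ℝ) ^ (1 + ε) = x * (x : ℝ) ^ ε := by
    rw [Real.rpow_add hX0, Real.rpow_one]
  have hxe8 : 8 * (x : ℝ) ≤ (x : ℝ) ^ (1 + ε) := by rw [hxe]; nlinarith
  have hDge : (x : ℝ) ^ (1 + ε) - 1 < D := by
    have := Nat.lt_floor_add_one ((x : ℝ) ^ (1 + ε))
    linarith
  have hD4 : 4 * x ≤ D := by
    have h : (4 * x : ℝ) ≤ D := by linarith
    exact_mod_cast h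
  have hDhalf : (x : ℝ) ^ (1 + ε) / 2 ≤ D := by linarith
  have hD1 : (1 : ℝ) ≤ D := by
    have : (4 : ℝ) ≤ 4 * x := by linarith
    have h4 : ((4 * x : ℕ) : ℝ) ≤ D := by exact_mod_cast hD4
    push_cast at h4
    linarith
  have hlogD : (1 + ε) * Real.log x - Real.log 2 ≤ Real.log D := by
    rw [← Real.log_rpow hX0, ← Real.log_div (by positivity) (by norm_num)]
    exact Real.log_le_log (by positivity) hDhalf
  have h4x1 : (1 : ℝ) ≤ ((4 * x : ℕ) : ℝ) := by push_cast; linarith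
  have hlog4x : Real.log (((4 * x : ℕ) : ℝ)) = Real.log 4 + Real.log x := by
    push_cast
    rw [Real.log_mul (by norm_num) hX0.ne']
  -- Mertens for `ρ` at `D` and at `4x`
  have hMD := hC D hD1
  have hM4 := hC _ h4x1
  rw [abs_le] at hMD hM4
  have hlog8 : Real.log 8 = Real.log 2 + Real.log 4 := by
    rw [← Real.log_mul (by norm_num) (by norm_num)]; norm_num
  have hmain : (x : ℝ) * (rhoLogSum D - rhoLogSum ((4 * x : ℕ) : ℝ))
      ≤ ∑ d ∈ (Icc 1 D).filter (fun d : ℕ => (x : ℝ) ^ (1 - ε) < d),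
          |(μ d : ℝ) * Real.log d * rem (x : ℝ) d| :=
    (mul_rhoLogSum_sub_le_sum_primes x D hD4).trans (sum_primes_le_absBalancedRange x D hx1 hε.le)
  refine le_trans ?_ hmain
  -- `(ε/2) x log x ≤ x (ε log x - log 8 - 2C) ≤ x (R(D) - R(4x))`
  have hεlog : Real.log 8 + 2 * C ≤ ε / 2 * Real.log x := by
    have := (div_le_iff₀ (by positivity : (0 : ℝ) < ε / 2)).mp hxlog
    linarith
  have hdiff : ε * Real.log x - Real.log 8 - 2 * C ≤ rhoLogSum D - rhoLogSum ((4 * x : ℕ) : ℝ) := by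
    rw [hlog4x] at hM4
    linarith [hMD.1, hM4.2]
  calc ε / 2 * x * Real.log x = x * (ε * Real.log x - ε / 2 * Real.log x) := by ring
    _ ≤ x * (ε * Real.log x - Real.log 8 - 2 * C) := mul_le_mul_of_nonneg_left (by linarith) hX0.le
    _ ≤ x * (rhoLogSum D - rhoLogSum ((4 * x : ℕ) : ℝ)) := mul_le_mul_of_nonneg_left hdiff hX0.le

/-- **`(R2)_ε` is false in absolute value**: for no `ε > 0` is
`∑_{x^{1-ε} < d ≤ x^{1+ε}} |μ(d) log d · rem(x; d)| ≤ δ x` eventually for every `δ > 0` (it fails already at `δ = 1`). -/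
theorem not_absBalancedRange_isLittleO {ε : ℝ} (hε : 0 < ε) :
    ¬ (∀ δ : ℝ, 0 < δ → ∀ᶠ x : ℕ in atTop,
        ∑ d ∈ (Icc 1 ⌊(x : ℝ) ^ (1 + ε)⌋₊).filter (fun d : ℕ => (x : ℝ) ^ (1 - ε) < d),
            |(μ d : ℝ) * Real.log d * rem (x : ℝ) d| ≤ δ * x) := by
  intro h
  have hlogT : Tendsto (fun x : ℕ => Real.log (x : ℝ)) atTop atTop :=
    Real.tendsto_log_atTop.comp tendsto_natCast_atTop_atTop
  have hev := (eventually_absBalancedRange_ge hε).and ((h 1 one_pos).and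
    ((hlogT.eventually_gt_atTop (2 / ε)).and (eventually_ge_atTop 1)))
  obtain ⟨x, hge, hle, hlog, hx1⟩ := hev.exists
  have hX0 : (0 : ℝ) < x := by exact_mod_cast hx1
  have h1 : ε / 2 * x * Real.log x ≤ 1 * x := hge.trans hle
  have h2 : ε / 2 * Real.log x ≤ 1 := by
    have := div_le_div_of_nonneg_right h1 hX0.le
    rwa [mul_assoc, mul_comm (x : ℝ), ← mul_assoc, mul_div_assoc, div_self hX0.ne', mul_one,
      one_mul, div_self hX0.ne'] at this
  have h3 : 2 / ε < Real.log x := hlog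
  rw [div_lt_iff₀ hε] at h3
  linarith

end Summit.Parity.BatemanHorn.Theorems
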